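import Literature.NumberTheory.LFunctions.SmoothedExplicitFormulaChar
import Literature.NumberTheory.LFunctions.LogDerivOneSidedBounds
import Literature.NumberTheory.LFunctions.DHTestFunctionBounds
import HarnessLib

/-!
# The Deuring–Heilbronn inequality for `K_{f,χ}(s)` (Heath-Brown 1992, Lemma 5.2 + Lemma 3.1)

Topic `Literature/NumberTheory/LFunctions`, sub-namespace `DHTest`. Everything here is PROVED;
`nearZeros` is glue (the finite set of non-trivial zeros within `δ` of `1 + it`).

Heath-Brown 1992, **Lemma 5.2**: combining the explicit formula (Lemma 5.1) with the one-sided bound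
for `−Re L'/L` (Lemma 3.1) — "the terms `f(0)/z` cancel" — gives, for `s = σ₀ + it` just to the
right of `1`,
`Re K(s, χ) ≤ −L Σ_{|1+it−ρ| ≤ δ} m(ρ) Re F((s−ρ)L) + f(0)(φ/2 + ε)ℒ + (errors)`.
Here, for a primitive `χ` mod `q > 1`, the test function `g = testFn x₀ ε₂ ε₀ L α` of
`DeuringHeilbronnTestFunction.lean` (so `F(z) = L·H(zL − α)`, `f(0) = h(0)`), `1 < σ₀ ≤ 5/4`,
`0 < δ ≤ 1/4` and the crude growth constant `2/(πR)`, `R ∈ [0.74, 0.75]` a zero-free radius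
(`JensenCarlemanBounds.neg_re_logDeriv_LFunction_le`), we prove (`re_charFordK_le`)

`Re K_{g,χ}(s) ≤ −Σ_{ρ ∈ T} m(ρ) L Re H((s−ρ)L − α)
   + h(0)·(θ₁' (log(2/(σ₀−1)) + log q + log(|t|+2) + log Z) + (Σ_{ρ∈T} m(ρ))(σ₀ − 1 + δ)/R₀²)
   + ‖Σ_{ρ ∉ T} m(ρ) F₀(s−ρ)‖ + ‖Σ_τ m(τ) F₀(s−τ)‖ + ‖J_χ(s)‖`,

`T = nearZeros χ t δ` the non-trivial zeros with `|ρ − (1+it)| ≤ δ`, `θ₁' = 2/(0.74π)`, `R₀ = 0.74`,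
the three norms being the far zeros, the trivial zeros and the left-line integral of the exact
explicit formula `ExplicitPsiChar.charFordK_eq_explicit`.

## References

* D. R. Heath-Brown, Proc. London Math. Soc. (3) 64 (1992), Lemma 3.1, Lemma 5.1, Lemma 5.2.
  [cite: HeathBrown1992PLMS, Lemma 5.2]
-/

noncomputable section

open Complex Real MeasureTheory Set Filter Topology Metric

namespace Literature.NumberTheory.LFunctions

namespace DHTest

open ExplicitPsiChar LaplaceShape JensenCarlemanBounds

variable {q : ℕ} [NeZero q] {χ : DirichletCharacter ℂ q}

/-- The non-trivial zeros of `L(·, χ)` within `δ` of `1 + it`, as a finite set of the index type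
`charNontrivialZeros χ`. [cite: HeathBrown1992PLMS, Lemma 3.1 ((3.7), |1+it-ρ| ≤ δ)] -/
def nearZeros (hχ : χ ≠ 1) (t δ : ℝ) : Finset (charNontrivialZeros χ) := by
  classical
  exact ((lfunctionZeroBox_finite hχ (|t| + δ)).toFinset.filter
    (fun ρ : ℂ ↦ ‖ρ - (1 + t * I)‖ ≤ δ)).subtype (· ∈ charNontrivialZeros χ)

/-- Membership in `nearZeros`. [folklore] -/
theorem mem_nearZeros {hχ : χ ≠ 1} {t δ : ℝ} {ρ : charNontrivialZeros χ} :
    ρ ∈ nearZeros hχ t δ ↔ ‖(ρ : ℂ) - (1 + t * I)‖ ≤ δ := by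
  classical
  rw [nearZeros, Finset.mem_subtype, Finset.mem_filter, Set.Finite.mem_toFinset, lfunctionZeroBox_eq_inter]
  constructor
  · exact fun h ↦ h.2
  · intro h
    refine ⟨⟨ρ.2, ?_⟩, h⟩
    have him : |(ρ : ℂ).im - t| ≤ δ := by
      have := Complex.abs_im_le_norm ((ρ : ℂ) - (1 + t * I))
      simp at this
      exact this.trans h
    have := abs_sub_abs_le_abs_sub (ρ : ℂ).im t
    show |(ρ : ℂ).im| ≤ |t| + δ
    linarith

/-- A near zero has `1 − δ ≤ Re ρ` and lies within `δ + (σ₀ − 1)` of `s = σ₀ + it`. [folklore] -/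
theorem re_ge_of_mem_nearZeros {hχ : χ ≠ 1} {t δ : ℝ} {ρ : charNontrivialZeros χ}
    (hρ : ρ ∈ nearZeros hχ t δ) : 1 - δ ≤ (ρ : ℂ).re := by
  have h := mem_nearZeros.1 hρ
  have := Complex.abs_re_le_norm ((ρ : ℂ) - (1 + t * I))
  simp at this
  have := this.trans h
  linarith [abs_le.1 this]

/-- A near zero lies within `δ + (σ₀ − 1)` of `s = σ₀ + it`. [folklore] -/
theorem norm_sub_le_of_mem_nearZeros {hχ : χ ≠ 1} {t δ σ₀ : ℝ} (hσ₀ : 1 ≤ σ₀)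
    {ρ : charNontrivialZeros χ} (hρ : ρ ∈ nearZeros hχ t δ) :
    ‖(ρ : ℂ) - (σ₀ + t * I)‖ ≤ δ + (σ₀ - 1) := by
  have h := mem_nearZeros.1 hρ
  have e : (ρ : ℂ) - (σ₀ + t * I) = ((ρ : ℂ) - (1 + t * I)) - ((σ₀ - 1 : ℝ) : ℂ) := by
    push_cast; ring
  rw [e]
  refine (norm_sub_le _ _).trans ?_
  rw [Complex.norm_real, Real.norm_eq_abs, abs_of_nonneg (by linarith)]
  linarith

/-- **The term-cancellation identity** (Heath-Brown: "the terms `f(0)/z` cancel"): for `z ≠ 0`,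
`h(0) Re(1/z) + Re F₀(z) = Re F(z) = L Re H(zL − α)`. [cite: HeathBrown1992PLMS, Lemma 5.2 (proof)] -/
theorem cancel_identity {x₀ ε₂ ε₀ L α : ℝ} (hx₀ : 0 ≤ x₀) (hε : 0 < ε₂) (hL : 0 < L) (z : ℂ) :
    shape x₀ ε₂ ε₀ 0 * (1 / z).re + (fordLaplace₀ (testFn x₀ ε₂ ε₀ L α) z).re =
      L * (shapeLaplace (shape x₀ ε₂ ε₀) x₀ (z * L - α)).re := by
  rw [fordLaplace₀_testFn hx₀ hε hL, Complex.sub_re, Complex.re_ofReal_mul]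
  have : ((shape x₀ ε₂ ε₀ 0 : ℂ) / z).re = shape x₀ ε₂ ε₀ 0 * (1 / z).re := by
    rw [div_eq_mul_one_div, Complex.re_ofReal_mul]
  rw [this]
  ring

/-- `2/(πR) ≤ 0.861` for `R ≥ 0.74`. [folklore] -/
theorem two_div_pi_mul_le {R : ℝ} (hR : 0.74 ≤ R) : 2 / (π * R) ≤ 0.861 := by
  have hπ := Real.pi_gt_d6
  rw [div_le_iff₀ (by positivity)]
  nlinarith

/-- **Heath-Brown's Lemma 5.2 for `χ`** (explicit formula + Lemma 3.1, the `f(0)/z` terms cancel).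
Let `χ` be primitive mod `q > 1`, `g = testFn x₀ ε₂ ε₀ L α` (`0 < ε₂ ≤ x₀`, `L > 0`, `0 ≤ α`),
`1 < σ₀ ≤ 5/4`, `0 < δ ≤ 1/4`, `s = σ₀ + it`, `T = nearZeros χ t δ`. Then
`Re K_{g,χ}(s) ≤ −Σ_{ρ∈T} m(ρ) L Re H((s−ρ)L − α)
  + h(0)(0.861 (log(2/(σ₀−1)) + log q + log(|t|+2) + log Z) + (Σ_{ρ∈T} m(ρ))(σ₀ − 1 + δ)/0.74²)
  + ‖Σ_{ρ∉T} m F₀(s−ρ)‖ + ‖Σ_τ m F₀(s−τ)‖ + ‖J_χ(s)‖`. [cite: HeathBrown1992PLMS, Lemma 5.2] -/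
theorem re_charFordK_le (hprim : χ.IsPrimitive) (hq : 1 < q) {x₀ ε₂ ε₀ L α : ℝ} (hε : 0 < ε₂)
    (hεx : ε₂ ≤ x₀) (hL : 0 < L) {σ₀ t δ : ℝ} (hσ₀ : 1 < σ₀) (hσ₀' : σ₀ ≤ 5 / 4)
    (hδ' : δ ≤ 1 / 4) :
    let hχ : χ ≠ 1 := ne_one_of_isPrimitive hprim hq
    let s : ℂ := (σ₀ : ℂ) + t * I
    let g := testFn x₀ ε₂ ε₀ L α
    let T := nearZeros hχ t δ
    (charFordK χ g s).re ≤
      -(∑ ρ ∈ T, (DirichletDisc.zeroOrder χ (ρ : ℂ) : ℝ) *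
          (L * (shapeLaplace (shape x₀ ε₂ ε₀) x₀ ((s - ρ) * L - α)).re)) +
        shape x₀ ε₂ ε₀ 0 * (0.861 * (Real.log (2 / (σ₀ - 1)) + Real.log q + Real.log (|t| + 2) +
          Real.log DirichletDisc.Zc) +
          (∑ ρ ∈ T, (DirichletDisc.zeroOrder χ (ρ : ℂ) : ℝ)) * ((σ₀ - 1 + δ) / 0.74 ^ 2)) +
        ‖∑' ρ : ↑((T : Set (charNontrivialZeros χ))ᶜ),
            (DirichletDisc.zeroOrder χ ((ρ : charNontrivialZeros χ) : ℂ) : ℂ) *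
              fordLaplace₀ g (s - (ρ : charNontrivialZeros χ))‖ +
        ‖∑ τ ∈ charTrivialZeroFinset hχ, (DirichletDisc.zeroOrder χ τ : ℂ) * fordLaplace₀ g (s - τ)‖ +
        ‖charEFRemainder χ g s‖ := by
  intro hχ s g T
  have hx₀ : 0 ≤ x₀ := hε.le.trans hεx
  set h := shape x₀ ε₂ ε₀ with hh
  set H := shapeLaplace h x₀ with hH
  set m : ℂ → ℕ := DirichletDisc.zeroOrder χ with hm
  have hsre : s.re = σ₀ := by simp [s]
  have hsim : s.im = t := by simp [s]
  have hLs : χ.LFunction s ≠ 0 :=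
    DirichletCharacter.LFunction_ne_zero_of_one_le_re χ (Or.inl hχ) (by rw [hsre]; exact hσ₀.le)
  have htest := isSmoothedEFTest_testFn (ε₀ := ε₀) (α := α) hx₀ hε hL
  -- (1) the exact explicit formula
  have hEF := charFordK_eq_explicit hprim hq htest (s := s) (by rw [hsre]; linarith) (by rw [hsre]; linarith) hLs
  have hsum := (summable_norm_charZeroTerm hprim hq htest (s := s) (by rw [hsre]; linarith) hLs).of_norm
  -- split the zero sum at `T`
  have hsplit := hsum.sum_add_tsum_compl (s := T)
  set Sfar := ∑' ρ : ↑((T : Set (charNontrivialZeros χ))ᶜ),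
    (m ((ρ : charNontrivialZeros χ) : ℂ) : ℂ) * fordLaplace₀ g (s - (ρ : charNontrivialZeros χ)) with hSfar
  set Striv := ∑ τ ∈ charTrivialZeroFinset hχ, (m τ : ℂ) * fordLaplace₀ g (s - τ) with hStriv
  set J := charEFRemainder χ g s with hJ
  have hK : charFordK χ g s = -(g 0 : ℂ) * (deriv χ.LFunction s / χ.LFunction s) -
      (∑ ρ ∈ T, (m (ρ : ℂ) : ℂ) * fordLaplace₀ g (s - ρ) + Sfar) - Striv + J := by
    rw [hEF, ← hsplit]
  -- (2) Lemma 3.1 at `s` with a zero-free radius `R ∈ [0.74, 0.75]`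
  have han : AnalyticOnNhd ℂ χ.LFunction (closedBall s 0.75) := DirichletDisc.analyticOnNhd_LFunction χ hχ _ _
  obtain ⟨R, hRmem, hRsph⟩ := exists_radius_sphere_ne_zero (R₁ := 0.74) (R₂ := 0.75) (by norm_num)
    (by norm_num) han hLs
  have hR1 : 0.74 ≤ R := hRmem.1
  have hR2 : R ≤ 0.75 := hRmem.2
  -- the finite set of near zeros as complex numbers
  classical
  set Tc : Finset ℂ := T.image Subtype.val with hTc
  have hTcP : ∀ ρ ∈ Tc, χ.LFunction ρ = 0 ∧ ‖ρ - (σ₀ + t * I)‖ ≤ R := by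
    intro ρ hρ
    obtain ⟨ρ', hρ', rfl⟩ := Finset.mem_image.1 hρ
    refine ⟨ρ'.2.1, (norm_sub_le_of_mem_nearZeros hσ₀.le hρ').trans ?_⟩
    linarith
  have hL31 := neg_re_logDeriv_LFunction_le hχ hσ₀ hσ₀' (by linarith) (by linarith) hRsph Tc hTcP
  rw [hTc, Finset.sum_image (fun a _ b _ hab ↦ Subtype.ext hab)] at hL31
  -- (3) real parts
  have hg0 : g 0 = h 0 := by simp only [g, hh]; rw [testFn_zero, shape_zero]
  have h0nn : 0 ≤ h 0 := by rw [hh]; exact shape_nonneg hε 0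
  have hre : (charFordK χ g s).re = -(h 0) * (deriv χ.LFunction s / χ.LFunction s).re -
      (∑ ρ ∈ T, ((m (ρ : ℂ) : ℂ) * fordLaplace₀ g (s - ρ)).re) - Sfar.re - Striv.re + J.re := by
    rw [hK]
    simp only [Complex.sub_re, Complex.add_re, Complex.neg_re, Complex.neg_im, Complex.mul_re,
      Complex.re_sum, Complex.ofReal_re, Complex.ofReal_im, Complex.natCast_re, Complex.natCast_im,
      neg_zero, zero_mul, sub_zero, hg0]
    ring
  rw [hre]
  -- the one-sided bound times `h 0 ≥ 0`
  have hθ := two_div_pi_mul_le hR1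
  have hE0 : 0 ≤ Real.log (2 / (σ₀ - 1)) + (Real.log q + Real.log (|t| + 2) + Real.log DirichletDisc.Zc) := by
    have h1 : 0 ≤ Real.log (2 / (σ₀ - 1)) := Real.log_nonneg (by rw [le_div_iff₀ (by linarith)]; linarith)
    have h2 : 0 ≤ Real.log q := Real.log_natCast_nonneg q
    have h3 : 0 ≤ Real.log (|t| + 2) := Real.log_nonneg (by linarith [abs_nonneg t])
    have h4 : 0 ≤ Real.log DirichletDisc.Zc := Real.log_nonneg DirichletDisc.one_le_Zc
    positivity
  have hmain : -(h 0) * (deriv χ.LFunction s / χ.LFunction s).re ≤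
      -(h 0) * (∑ ρ ∈ T, (m (ρ : ℂ) : ℝ) * (1 / (s - ρ) + ((ρ : ℂ) - s) / (R : ℂ) ^ 2).re) +
        h 0 * (0.861 * (Real.log (2 / (σ₀ - 1)) + Real.log q + Real.log (|t| + 2) +
          Real.log DirichletDisc.Zc)) := by
    have h1 : -(h 0) * (deriv χ.LFunction s / χ.LFunction s).re =
        h 0 * (-(deriv χ.LFunction s / χ.LFunction s).re) := by ring
    rw [h1]
    refine (mul_le_mul_of_nonneg_left hL31 h0nn).trans ?_
    have h2 : 2 * (Real.log (2 / (σ₀ - 1)) + (Real.log q + Real.log (|t| + 2) + Real.log DirichletDisc.Zc)) /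
        (π * R) ≤ 0.861 * (Real.log (2 / (σ₀ - 1)) + Real.log q + Real.log (|t| + 2) +
          Real.log DirichletDisc.Zc) := by
      rw [show 2 * (Real.log (2 / (σ₀ - 1)) + (Real.log q + Real.log (|t| + 2) + Real.log DirichletDisc.Zc)) /
        (π * R) = 2 / (π * R) * (Real.log (2 / (σ₀ - 1)) + Real.log q + Real.log (|t| + 2) +
          Real.log DirichletDisc.Zc) by ring]
      exact mul_le_mul_of_nonneg_right hθ (by linarith)
    nlinarith
  -- (4) combine the near-zero terms: `h0 Re(1/(s−ρ)) + Re F₀(s−ρ) = L Re H(W_ρ)`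
  have hnear : ∀ ρ ∈ T, -(h 0) * ((m (ρ : ℂ) : ℝ) * (1 / (s - ρ) + ((ρ : ℂ) - s) / (R : ℂ) ^ 2).re) -
      ((m (ρ : ℂ) : ℂ) * fordLaplace₀ g (s - ρ)).re ≤
      -((m (ρ : ℂ) : ℝ) * (L * (H ((s - ρ) * L - α)).re)) +
        h 0 * ((m (ρ : ℂ) : ℝ) * ((σ₀ - 1 + δ) / 0.74 ^ 2)) := by
    intro ρ hρ
    have hρre := re_ge_of_mem_nearZeros hρ
    have hρ1 : (ρ : ℂ).re < 1 := ρ.2.2.2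
    have hcancel := cancel_identity (ε₀ := ε₀) (α := α) hx₀ hε hL (s - ρ)
    have hmre : ((m (ρ : ℂ) : ℂ) * fordLaplace₀ g (s - ρ)).re = (m (ρ : ℂ) : ℝ) * (fordLaplace₀ g (s - ρ)).re := by
      rw [show ((m (ρ : ℂ) : ℕ) : ℂ) = ((m (ρ : ℂ) : ℝ) : ℂ) by simp, Complex.re_ofReal_mul]
    rw [hmre, Complex.add_re]
    -- the `(ρ − s)/R²` term: `Re = (β − σ₀)/R² ≥ −(σ₀ − 1 + δ)/R² ≥ −(σ₀−1+δ)/0.74²`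
    have hR2re : (((ρ : ℂ) - s) / (R : ℂ) ^ 2).re = ((ρ : ℂ).re - σ₀) / R ^ 2 := by
      rw [show ((R : ℂ) ^ 2) = ((R ^ 2 : ℝ) : ℂ) by push_cast; ring, Complex.div_ofReal_re, Complex.sub_re, hsre]
    have hterm : -(((ρ : ℂ).re - σ₀) / R ^ 2) ≤ (σ₀ - 1 + δ) / 0.74 ^ 2 := by
      rw [← neg_div, neg_sub]
      have hnum : σ₀ - (ρ : ℂ).re ≤ σ₀ - 1 + δ := by linarith
      have hnum0 : 0 ≤ σ₀ - (ρ : ℂ).re := by linarith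
      calc (σ₀ - (ρ : ℂ).re) / R ^ 2 ≤ (σ₀ - (ρ : ℂ).re) / 0.74 ^ 2 :=
            div_le_div_of_nonneg_left hnum0 (by norm_num) (by nlinarith)
        _ ≤ (σ₀ - 1 + δ) / 0.74 ^ 2 := div_le_div_of_nonneg_right hnum (by norm_num)
    have hm0 : (0 : ℝ) ≤ m (ρ : ℂ) := Nat.cast_nonneg _
    have key : -(h 0) * ((m (ρ : ℂ) : ℝ) * ((1 / (s - (ρ : ℂ))).re + (((ρ : ℂ) - s) / (R : ℂ) ^ 2).re)) -
        (m (ρ : ℂ) : ℝ) * (fordLaplace₀ g (s - ρ)).re =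
        -((m (ρ : ℂ) : ℝ) * (h 0 * (1 / (s - (ρ : ℂ))).re + (fordLaplace₀ g (s - ρ)).re)) +
          h 0 * ((m (ρ : ℂ) : ℝ) * (-((((ρ : ℂ) - s) / (R : ℂ) ^ 2).re))) := by ring
    rw [key, hcancel, hR2re]
    have : h 0 * ((m (ρ : ℂ) : ℝ) * -(((ρ : ℂ).re - σ₀) / R ^ 2)) ≤
        h 0 * ((m (ρ : ℂ) : ℝ) * ((σ₀ - 1 + δ) / 0.74 ^ 2)) :=
      mul_le_mul_of_nonneg_left (mul_le_mul_of_nonneg_left hterm hm0) h0nn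
    linarith
  -- assemble
  have e1 : -(h 0) * (∑ ρ ∈ T, (m (ρ : ℂ) : ℝ) * (1 / (s - ρ) + ((ρ : ℂ) - s) / (R : ℂ) ^ 2).re) -
      ∑ ρ ∈ T, ((m (ρ : ℂ) : ℂ) * fordLaplace₀ g (s - ρ)).re =
      ∑ ρ ∈ T, (-(h 0) * ((m (ρ : ℂ) : ℝ) * (1 / (s - ρ) + ((ρ : ℂ) - s) / (R : ℂ) ^ 2).re) -
        ((m (ρ : ℂ) : ℂ) * fordLaplace₀ g (s - ρ)).re) := by
    rw [Finset.sum_sub_distrib, Finset.mul_sum]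
  have e2 : ∑ ρ ∈ T, (-((m (ρ : ℂ) : ℝ) * (L * (H ((s - ρ) * L - α)).re)) +
        h 0 * ((m (ρ : ℂ) : ℝ) * ((σ₀ - 1 + δ) / 0.74 ^ 2))) =
      -(∑ ρ ∈ T, (m (ρ : ℂ) : ℝ) * (L * (H ((s - ρ) * L - α)).re)) +
        h 0 * ((∑ ρ ∈ T, (m (ρ : ℂ) : ℝ)) * ((σ₀ - 1 + δ) / 0.74 ^ 2)) := by
    rw [Finset.sum_add_distrib, Finset.sum_neg_distrib, ← Finset.mul_sum, ← Finset.sum_mul]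
  have hS : -Sfar.re ≤ ‖Sfar‖ := (neg_le_abs _).trans (Complex.abs_re_le_norm _)
  have hSt : -Striv.re ≤ ‖Striv‖ := (neg_le_abs _).trans (Complex.abs_re_le_norm _)
  have hJ' : J.re ≤ ‖J‖ := (le_abs_self _).trans (Complex.abs_re_le_norm _)
  have hsumle : ∑ ρ ∈ T, (-(h 0) * ((m (ρ : ℂ) : ℝ) * (1 / (s - ρ) + ((ρ : ℂ) - s) / (R : ℂ) ^ 2).re) -
        ((m (ρ : ℂ) : ℂ) * fordLaplace₀ g (s - ρ)).re) ≤
      ∑ ρ ∈ T, (-((m (ρ : ℂ) : ℝ) * (L * (H ((s - ρ) * L - α)).re)) +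
        h 0 * ((m (ρ : ℂ) : ℝ) * ((σ₀ - 1 + δ) / 0.74 ^ 2))) := Finset.sum_le_sum hnear
  rw [e2] at hsumle
  linarith [hmain, hsumle, e1]

end DHTest

end Literature.NumberTheory.LFunctions

end
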